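import Summits.Ventures.PercRepro.RankLevelSetUpFiveDeletion
import Summits.Ventures.PercRepro.RankLevelSetUpPairChain

/-! # RankLevelSetUpPairDeletion — THE DELETION-AVERAGING STEP FOR THE PAIR (↑) AT LEVEL `5`: THE PAIR (↑)₅ ON EVERY
`M ／ x` PLUS THE PAIR COLOOP RESIDUE (P₂) GIVE THE PAIR (↑)₅ ON `M` (night-1 g40; dossier §52.15; on
`RankLevelSetUpFiveDeletion` and `RankLevelSetUpPairChain`)

The pair version of `RankLevelSetUpFiveDeletion`: summing the pair (↑)₅ at `{b, c}` over the contractions `M ／ x`,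
`x ∉ {b, c}`, gives `Σ_{W ∈ T^{bc}_5} (#E − 5 − c₀ W) ≤ Σ_{Z ∈ V^{bc}_6} (#E − 8 − c₀'' Z)` (**`sum_throughPair_contract`**,
**`sum_avoidPair_contract`**) with `c₀'' Z = #{t ∈ (E ∖ Z) ∖ {b, c} : t ∈ cl Z}`. The RESIDUE
**`UpPairFiveDeletionResidue M b c`** is `Σ_{W ∈ T^{bc}_5} c₀ W ≤ 3 · T^{bc}_5 + Σ_{Z ∈ V^{bc}_6} c₀'' Z` (a `Prop`, NOT
asserted), trivially true when every complement has `≤ 2` coloops (**`upPairFiveDeletionResidue_of_bound_two`**,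
hence on line-sparse duals of nullity `≤ 5`: **`upPairFiveDeletionResidue_of_lineSparse`**). Hence
**`upPairAt_five_of_contract_of_residue`**: `M` loopless, `b ≠ c ∈ E`, `9 ≤ #E`, the pair (↑)₅ at `{b, c}` on every
`M ／ x` (`x ∉ {b, c}`) and the residue ⟹ `BiIndepUpPairAt M b c 5`. Every declaration has a docstring; imports: the
cell's own modules and Mathlib only. Axioms: standard. -/

namespace PercRepro

open Set Matroid Finset

variable {α : Type} (M : Matroid α) [M.Finite]

/-! ## The pair residue -/

/-- The avoid-`{b,c}` family at level `k` is finite. -/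
lemma avoidPair_finite (b c : α) (k : ℕ) : {Z ∈ biIndep M k | b ∉ Z ∧ c ∉ Z}.Finite :=
  (biIndep_finite M k).subset (fun _ h => h.1)

omit [M.Finite] in
/-- **THE PAIR COLOOP RESIDUE (P₂) OF THE DELETION-AVERAGING STEP AT LEVEL `5`** (night-1 g40; a `Prop`, NOT
asserted): `Σ_{W ∈ T^{bc}_5} #{t ∈ E ∖ W : t ∈ cl W} ≤ 3 · T^{bc}_5 + Σ_{Z ∈ V^{bc}_6} #{t ∈ (E ∖ Z) ∖ {b, c} : t ∈ cl Z}`. -/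
def UpPairFiveDeletionResidue (b c : α) : Prop :=
  ∑ W ∈ (throughPair_finite M b c 5).toFinset, {t ∈ M.E \ W | t ∈ M.closure W}.ncard ≤
    3 * {W ∈ biIndep M 5 | b ∈ W ∧ c ∈ W}.ncard +
      ∑ Z ∈ (avoidPair_finite M b c 6).toFinset, {t ∈ (M.E \ Z) \ {b, c} | t ∈ M.closure Z}.ncard

/-- **The pair residue holds when every through-`{b,c}` complement has at most two coloops.** -/
lemma upPairFiveDeletionResidue_of_bound_two {b c : α}
    (hbound : ∀ W ∈ biIndep M 5, b ∈ W → c ∈ W → {t ∈ M.E \ W | t ∈ M.closure W}.ncard ≤ 2) :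
    UpPairFiveDeletionResidue M b c := by
  unfold UpPairFiveDeletionResidue
  have h1 : ∑ W ∈ (throughPair_finite M b c 5).toFinset, {t ∈ M.E \ W | t ∈ M.closure W}.ncard ≤
      ∑ W ∈ (throughPair_finite M b c 5).toFinset, 2 := by
    refine Finset.sum_le_sum ?_
    intro W hW
    rw [Set.Finite.mem_toFinset] at hW
    exact hbound W hW.1 hW.2.1 hW.2.2
  rw [Finset.sum_const, smul_eq_mul, ← Set.ncard_eq_toFinset_card _ (throughPair_finite M b c 5)] at h1
  omega

/-- **The pair residue holds on a matroid of nullity `≤ 5` with a line-sparse dual and `≥ 12` elements.** -/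
lemma upPairFiveDeletionResidue_of_lineSparse (hν : M✶.eRank ≤ 5) (hls : LineSparse M✶) (hn : 12 ≤ M.E.ncard)
    (b c : α) : UpPairFiveDeletionResidue M b c :=
  upPairFiveDeletionResidue_of_bound_two M (fun W hW _ _ => bound_two_of_lineSparse M hν hls hW (by omega))

/-! ## The deletion-averaging step -/

omit [M.Finite] in
/-- **The through-`{b,c}` family of `M ／ x` at level `5`, read in `M`**: for a nonloop `x`,
`{W ∈ D_5(M ／ x) : b, c ∈ W} = {W ∈ T^{bc}_5 : x ∉ W ∧ x ∉ cl W}`. -/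
lemma throughPair_contract_eq {x : α} (hx : M.IsNonloop x) (b c : α) :
    {W ∈ biIndep (M.contract {x}) 5 | b ∈ W ∧ c ∈ W} =
      {W ∈ {W ∈ biIndep M 5 | b ∈ W ∧ c ∈ W} | x ∉ W ∧ x ∉ M.closure W} := by
  ext W
  simp only [Set.mem_setOf_eq, mem_biIndep_contract_iff M hx]
  tauto

omit [M.Finite] in
/-- **The avoid-`{b,c}` family of `M ／ x` at level `6`, read in `M`**: for a nonloop `x`,
`{Z ∈ D_6(M ／ x) : b, c ∉ Z} = {Z ∈ V^{bc}_6 : x ∉ Z ∧ x ∉ cl Z}`. -/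
lemma avoidPair_contract_eq {x : α} (hx : M.IsNonloop x) (b c : α) :
    {Z ∈ biIndep (M.contract {x}) 6 | b ∉ Z ∧ c ∉ Z} =
      {Z ∈ {Z ∈ biIndep M 6 | b ∉ Z ∧ c ∉ Z} | x ∉ Z ∧ x ∉ M.closure Z} := by
  ext Z
  simp only [Set.mem_setOf_eq, mem_biIndep_contract_iff M hx]
  tauto

/-- **The up-neighbours of a through-`{b,c}` member in the contractions**: for `W ∈ T^{bc}_5`,
`#{x ∈ E ∖ {b, c} : x ∉ W ∧ x ∉ cl W} = #E − 5 − c₀ W`. -/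
lemma ncard_filter_throughPair {b c : α} {W : Set α} (hW : W ∈ biIndep M 5) (hbW : b ∈ W) (hcW : c ∈ W) :
    {x ∈ M.E \ {b, c} | x ∉ W ∧ x ∉ M.closure W}.ncard =
      M.E.ncard - 5 - {t ∈ M.E \ W | t ∈ M.closure W}.ncard := by
  have hEW : (M.E \ W).Finite := M.ground_finite.subset Set.sdiff_subset
  have hsub : {t ∈ M.E \ W | t ∈ M.closure W} ⊆ M.E \ W := fun t ht => ht.1
  have hcard : (M.E \ W).ncard = M.E.ncard - 5 := by
    rw [Set.ncard_sdiff' hW.1 M.ground_finite, hW.2.1]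
  rw [← hcard, ← Set.ncard_sdiff hsub (hEW.subset hsub)]
  congr 1
  ext x
  constructor
  · rintro ⟨⟨hxE, -⟩, hxW, hxcl⟩
    exact ⟨⟨hxE, hxW⟩, fun h => hxcl h.2⟩
  · rintro ⟨⟨hxE, hxW⟩, h⟩
    refine ⟨⟨hxE, fun hxbc => hxW ?_⟩, hxW, fun hxcl => h ⟨⟨hxE, hxW⟩, hxcl⟩⟩
    rcases hxbc with rfl | hxc
    · exact hbW
    · rw [Set.mem_singleton_iff] at hxc; rw [hxc]; exact hcW

/-- **The up-neighbours of an avoid-`{b,c}` member in the contractions**: for `Z ∈ V^{bc}_6`,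
`#{x ∈ E ∖ {b, c} : x ∉ Z ∧ x ∉ cl Z} = #E − 8 − c₀'' Z`. -/
lemma ncard_filter_avoidPair {b c : α} (hb : b ∈ M.E) (hc : c ∈ M.E) (hbc : b ≠ c) {Z : Set α}
    (hZ : Z ∈ biIndep M 6) (hbZ : b ∉ Z) (hcZ : c ∉ Z) :
    {x ∈ M.E \ {b, c} | x ∉ Z ∧ x ∉ M.closure Z}.ncard =
      M.E.ncard - 8 - {t ∈ (M.E \ Z) \ {b, c} | t ∈ M.closure Z}.ncard := by
  have hEZ : ((M.E \ Z) \ {b, c}).Finite := M.ground_finite.subset (Set.sdiff_subset.trans Set.sdiff_subset)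
  have hsub : {t ∈ (M.E \ Z) \ {b, c} | t ∈ M.closure Z} ⊆ (M.E \ Z) \ {b, c} := fun t ht => ht.1
  have hpair : ({b, c} : Set α) ⊆ M.E \ Z := by
    intro y hy
    rcases hy with rfl | hy
    · exact ⟨hb, hbZ⟩
    · rw [Set.mem_singleton_iff] at hy; rw [hy]; exact ⟨hc, hcZ⟩
  have hcard : ((M.E \ Z) \ {b, c}).ncard = M.E.ncard - 8 := by
    rw [Set.ncard_sdiff hpair (Set.toFinite _), Set.ncard_pair hbc, Set.ncard_sdiff' hZ.1 M.ground_finite, hZ.2.1]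
    omega
  rw [← hcard, ← Set.ncard_sdiff hsub (hEZ.subset hsub)]
  congr 1
  ext x
  constructor
  · rintro ⟨⟨hxE, hxbc⟩, hxZ, hxcl⟩
    exact ⟨⟨⟨hxE, hxZ⟩, hxbc⟩, fun h => hxcl h.2⟩
  · rintro ⟨⟨⟨hxE, hxZ⟩, hxbc⟩, h⟩
    exact ⟨⟨hxE, hxbc⟩, hxZ, fun hxcl => h ⟨⟨⟨hxE, hxZ⟩, hxbc⟩, hxcl⟩⟩

/-- **THE SUM OF THE THROUGH-`{b,c}` COUNTS OVER THE CONTRACTIONS**: on a loopless `M`,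
`Σ_{x ∈ E ∖ {b, c}} #{W ∈ D_5(M ／ x) : b, c ∈ W} = Σ_{W ∈ T^{bc}_5} (#E − 5 − c₀ W)`. -/
lemma sum_throughPair_contract (hloop : ∀ e, ¬ M.IsLoop e) (b c : α) :
    ∑ x ∈ (M.ground_finite.subset (Set.sdiff_subset (t := {b, c}))).toFinset,
        {W ∈ biIndep (M.contract {x}) 5 | b ∈ W ∧ c ∈ W}.ncard =
      ∑ W ∈ (throughPair_finite M b c 5).toFinset, (M.E.ncard - 5 - {t ∈ M.E \ W | t ∈ M.closure W}.ncard) := by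
  have hstep : ∀ x ∈ (M.ground_finite.subset (Set.sdiff_subset (t := {b, c}))).toFinset,
      {W ∈ biIndep (M.contract {x}) 5 | b ∈ W ∧ c ∈ W}.ncard =
        {W ∈ {W ∈ biIndep M 5 | b ∈ W ∧ c ∈ W} | x ∉ W ∧ x ∉ M.closure W}.ncard := by
    intro x hx
    rw [Set.Finite.mem_toFinset] at hx
    have hxnl : M.IsNonloop x := Matroid.isNonloop_of_not_isLoop hx.1 (hloop x)
    rw [throughPair_contract_eq M hxnl b c]
  rw [Finset.sum_congr rfl hstep,
    sum_ncard_comm (M.ground_finite.subset (Set.sdiff_subset (t := {b, c}))) (throughPair_finite M b c 5)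
      (fun x W => x ∉ W ∧ x ∉ M.closure W)]
  refine Finset.sum_congr rfl ?_
  intro W hW
  rw [Set.Finite.mem_toFinset] at hW
  exact ncard_filter_throughPair M hW.1 hW.2.1 hW.2.2

/-- **THE SUM OF THE AVOID-`{b,c}` COUNTS OVER THE CONTRACTIONS**: on a loopless `M` with `b ≠ c ∈ E`,
`Σ_{x ∈ E ∖ {b, c}} #{Z ∈ D_6(M ／ x) : b, c ∉ Z} = Σ_{Z ∈ V^{bc}_6} (#E − 8 − c₀'' Z)`. -/
lemma sum_avoidPair_contract (hloop : ∀ e, ¬ M.IsLoop e) {b c : α} (hb : b ∈ M.E) (hc : c ∈ M.E) (hbc : b ≠ c) :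
    ∑ x ∈ (M.ground_finite.subset (Set.sdiff_subset (t := {b, c}))).toFinset,
        {Z ∈ biIndep (M.contract {x}) 6 | b ∉ Z ∧ c ∉ Z}.ncard =
      ∑ Z ∈ (avoidPair_finite M b c 6).toFinset,
        (M.E.ncard - 8 - {t ∈ (M.E \ Z) \ {b, c} | t ∈ M.closure Z}.ncard) := by
  have hstep : ∀ x ∈ (M.ground_finite.subset (Set.sdiff_subset (t := {b, c}))).toFinset,
      {Z ∈ biIndep (M.contract {x}) 6 | b ∉ Z ∧ c ∉ Z}.ncard =
        {Z ∈ {Z ∈ biIndep M 6 | b ∉ Z ∧ c ∉ Z} | x ∉ Z ∧ x ∉ M.closure Z}.ncard := by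
    intro x hx
    rw [Set.Finite.mem_toFinset] at hx
    have hxnl : M.IsNonloop x := Matroid.isNonloop_of_not_isLoop hx.1 (hloop x)
    rw [avoidPair_contract_eq M hxnl b c]
  rw [Finset.sum_congr rfl hstep,
    sum_ncard_comm (M.ground_finite.subset (Set.sdiff_subset (t := {b, c}))) (avoidPair_finite M b c 6)
      (fun x Z => x ∉ Z ∧ x ∉ M.closure Z)]
  refine Finset.sum_congr rfl ?_
  intro Z hZ
  rw [Set.Finite.mem_toFinset] at hZ
  exact ncard_filter_avoidPair M hb hc hbc hZ.1 hZ.2.1 hZ.2.2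

/-- **THE PAIR (↑) AT LEVEL `5` FROM THE PAIR (↑) AT LEVEL `5` ON THE CONTRACTIONS `M ／ x` AND THE PAIR COLOOP
RESIDUE** (`M` loopless, `b ≠ c ∈ E`, `9 ≤ #E`): summing `T^{bc}_5(M ／ x) ≤ V^{bc}_6(M ／ x)` over `x ∉ {b, c}` gives
`(#E − 5) T − Σ c₀ ≤ (#E − 8) V − Σ c₀''`, and the residue `Σ c₀ ≤ 3 T + Σ c₀''` turns it into
`(#E − 8) T ≤ (#E − 8) V`. -/
theorem upPairAt_five_of_contract_of_residue (hloop : ∀ e, ¬ M.IsLoop e) {b c : α} (hb : b ∈ M.E) (hc : c ∈ M.E)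
    (hbc : b ≠ c) (hn : 9 ≤ M.E.ncard)
    (hih : ∀ x ∈ M.E \ {b, c}, BiIndepUpPairAt (M.contract {x}) b c 5)
    (hres : UpPairFiveDeletionResidue M b c) : BiIndepUpPairAt M b c 5 := by
  unfold BiIndepUpPairAt
  unfold UpPairFiveDeletionResidue at hres
  show {W ∈ biIndep M 5 | b ∈ W ∧ c ∈ W}.ncard ≤ {Z ∈ biIndep M 6 | b ∉ Z ∧ c ∉ Z}.ncard
  set Ef := (M.ground_finite.subset (Set.sdiff_subset (t := {b, c}))).toFinset with hEf
  set Tf := (throughPair_finite M b c 5).toFinset with hTf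
  set Vf := (avoidPair_finite M b c 6).toFinset with hVf
  set n := M.E.ncard with hn'
  have hsum : ∑ x ∈ Ef, {W ∈ biIndep (M.contract {x}) 5 | b ∈ W ∧ c ∈ W}.ncard ≤
      ∑ x ∈ Ef, {Z ∈ biIndep (M.contract {x}) 6 | b ∉ Z ∧ c ∉ Z}.ncard := by
    refine Finset.sum_le_sum ?_
    intro x hx
    rw [hEf, Set.Finite.mem_toFinset] at hx
    exact hih x hx
  rw [sum_throughPair_contract M hloop b c, sum_avoidPair_contract M hloop hb hc hbc] at hsum
  have hT : Tf.card = {W ∈ biIndep M 5 | b ∈ W ∧ c ∈ W}.ncard :=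
    (Set.ncard_eq_toFinset_card _ (throughPair_finite M b c 5)).symm
  have hV : Vf.card = {Z ∈ biIndep M 6 | b ∉ Z ∧ c ∉ Z}.ncard :=
    (Set.ncard_eq_toFinset_card _ (avoidPair_finite M b c 6)).symm
  have hc₀ : ∀ W ∈ Tf, {t ∈ M.E \ W | t ∈ M.closure W}.ncard ≤ n - 5 := by
    intro W hW
    rw [hTf, Set.Finite.mem_toFinset] at hW
    have h := Set.ncard_le_ncard (s := {t ∈ M.E \ W | t ∈ M.closure W}) (t := M.E \ W) (fun t ht => ht.1)
      (M.ground_finite.subset Set.sdiff_subset)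
    rw [Set.ncard_sdiff' hW.1.1 M.ground_finite, hW.1.2.1] at h
    exact h
  have hc₀' : ∀ Z ∈ Vf, {t ∈ (M.E \ Z) \ {b, c} | t ∈ M.closure Z}.ncard ≤ n - 8 := by
    intro Z hZ
    rw [hVf, Set.Finite.mem_toFinset] at hZ
    have h := Set.ncard_le_ncard (s := {t ∈ (M.E \ Z) \ {b, c} | t ∈ M.closure Z}) (t := (M.E \ Z) \ {b, c})
      (fun t ht => ht.1) (M.ground_finite.subset (Set.sdiff_subset.trans Set.sdiff_subset))
    have hpair : ({b, c} : Set α) ⊆ M.E \ Z := by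
      intro y hy
      rcases hy with rfl | hy
      · exact ⟨hb, hZ.2.1⟩
      · rw [Set.mem_singleton_iff] at hy; rw [hy]; exact ⟨hc, hZ.2.2⟩
    rw [Set.ncard_sdiff hpair (Set.toFinite _), Set.ncard_pair hbc, Set.ncard_sdiff' hZ.1.1 M.ground_finite,
      hZ.1.2.1] at h
    omega
  rw [Finset.sum_tsub_distrib _ hc₀, Finset.sum_tsub_distrib _ hc₀', Finset.sum_const, Finset.sum_const,
    smul_eq_mul, smul_eq_mul, hT, hV] at hsum
  have hS₁ : ∑ W ∈ Tf, {t ∈ M.E \ W | t ∈ M.closure W}.ncard ≤ Tf.card * (n - 5) := by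
    calc ∑ W ∈ Tf, {t ∈ M.E \ W | t ∈ M.closure W}.ncard ≤ ∑ W ∈ Tf, (n - 5) := Finset.sum_le_sum hc₀
      _ = Tf.card * (n - 5) := by rw [Finset.sum_const, smul_eq_mul]
  have hS₂ : ∑ Z ∈ Vf, {t ∈ (M.E \ Z) \ {b, c} | t ∈ M.closure Z}.ncard ≤ Vf.card * (n - 8) := by
    calc ∑ Z ∈ Vf, {t ∈ (M.E \ Z) \ {b, c} | t ∈ M.closure Z}.ncard ≤ ∑ Z ∈ Vf, (n - 8) :=
          Finset.sum_le_sum hc₀'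
      _ = Vf.card * (n - 8) := by rw [Finset.sum_const, smul_eq_mul]
  rw [hT] at hS₁; rw [hV] at hS₂
  set T := {W ∈ biIndep M 5 | b ∈ W ∧ c ∈ W}.ncard with hTdef
  set V := {Z ∈ biIndep M 6 | b ∉ Z ∧ c ∉ Z}.ncard with hVdef
  set S₁ := ∑ W ∈ Tf, {t ∈ M.E \ W | t ∈ M.closure W}.ncard with hS₁def
  set S₂ := ∑ Z ∈ Vf, {t ∈ (M.E \ Z) \ {b, c} | t ∈ M.closure Z}.ncard with hS₂def
  have e5 : T * (n - 5) = T * (n - 8) + 3 * T := by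
    have : n - 5 = (n - 8) + 3 := by omega
    rw [this, Nat.mul_add]; ring
  have key : T * (n - 8) ≤ V * (n - 8) := by omega
  exact Nat.le_of_mul_le_mul_right key (by omega)

end PercRepro
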